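import Literature.IUT.HodgeTheaters.GenuineFKitMergeInputsThetaSide
import Literature.IUT.HodgeTheaters.GenuineFKitMergeInputsBadSlot
import Literature.AlgebraicGeometry.Frobenioids.PadicFrobenioidMonogenicUnitInversionTwist
import HarnessLib

/-!
# [IUTchI] Cor 5.3 (ii) bad slot at OUR stand-ins — NEGATIVE NOTE (OURS): the law `hker@hull` = `RigidOverBase (hull ⋙ toBase)` of the merge
# term's (m1) hull slot is FALSE AS TYPED at both Θ-side stand-ins of record, because their hull `𝒞_v̲` carries the REAL monogenic `𝒞⊢_v̲` as a
# disjoint summand and `Aut(𝒞⊢_v̲) → Aut(𝒟⊢_v̲)` has non-trivial kernel (the unit-inversion twist)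

S. Mochizuki, *Inter-universal Teichmüller theory I*, kurims manuscript (May 2020), §5 Cor. 5.3 (ii) p. 144 l. 12–15 («the natural map
`Isom(¹𝔉, ²𝔉) → Isom(¹𝔇, ²𝔇)` is bijective»), proof l. 33–36 ([AbsTopIII] Prop. 3.2 (iv), Prop. 4.2 (i)); Cor. 5.3 (iii) p. 144 l. 16–19
(«`Isom(¹𝔉⊢, ²𝔉⊢) → Isom(¹𝔇⊢, ²𝔇⊢)` is surjective»); Def. 5.2 (i)(a) p. 134 («`‡ℱ_v` is a category `‡𝒞_v` which admits an equivalence of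
categories `‡𝒞_v ⥲ 𝒞_v` [where `𝒞_v` is as in Examples 3.2, (iii); 3.3, (i)]»); Ex. 3.2 (iii) p. 71 («the `p_v`-adic Frobenioid constituted by
the base-field-theoretic hull `𝒞_v ⊆ ℱ̲_v`»), (iv) p. 71 («`Φ_{𝒞⊢_v} := ℕ·log_Φ(q̲_v)|_{𝒟⊢_v}` … determines a `p_v`-adic Frobenioid with base
category given by `𝒟⊢_v` [cf. [FrdII], Example 1.1, (ii)] `𝒞⊢_v (⊆ 𝒞_v …)`») ([IUTchI] Cor 5.3 (ii) p.144) [claim: Mochizuki2012, status: disputed]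
(D-0012 claim key, series status DISPUTED; nothing of the series is asserted; no side is taken on [IUTchIII] Cor. 3.12).  S. Mochizuki,
*The geometry of Frobenioids II* (2008), Ex. 1.1 (ii) p. 8 [cite: MochizukiFrdII2008, Ex 1.1 (ii) p.8]; *The geometry of Frobenioids I*
(2008), Thm. 5.2 (i) p. 100 [cite: MochizukiFrdI2008, Thm. 5.2(i) p.100].

PROOF-ONLY (cell abc-iut, seat abc-iut-L5-t4 gen 8, KEY R72 «COR53II-BAD-SLOT-LAWS@STAND-IN» (1) — negative knowledge of record for the
IUTchI:Cor5.3(ii) residual, COUNT-NEUTRAL; abc-iut-L5-lead RULINGS #161 (4) / #163 (1)).  THE LAW.  abc-iut-L5's read-out of Cor 5.3 (ii) at the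
`ℱ`-slot of a bad index (★ `InitialThetaData.badLiftAt_model_case_iff`, `GenuineFKitMergeInputsBadSlot`) is «bijective ↔ `LiftsAll` ∧
`RigidOverBase ((D.frobeniusBadAt B I x hx).hull ⋙ (D.frobeniusBadAt B I x hx).toBase)`»; the second conjunct (`hker@hull`: every
self-equivalence of the hull category `𝒞_v̲` lying over `𝟭_{𝒟_v̲}` is `≅ 𝟭`) is a statement about the merge record's INPUT slot `I.m1 x hx`.
THE STAND-INS OF RECORD.  (A) abc-iut-L5-t3's `badTemperedSideModel` (★ `MergeInputs.ofGroupData`, the named record ★ `mergeInputsStandIn`):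
`𝒞_v̲ := 𝒞⊢_v̲` ITSELF, `hull ⋙ toBase ≅ CdashBase ⋙ incl` (★ `sumHullBaseIso`); (B) abc-iut-L2-t7's `badTemperedSideOfThetaTower`
(★ `MergeInputs.ofGroupDataThetaTower`, ★ `mergeInputsThetaTowerStandIn`, ★ `MergeInputs.thetaTowerOfClosed`): `𝒞_v̲ := C_{A₀}^{bs-fld} ⊕ 𝒞⊢_v̲`,
`inr ⋙ hull ⋙ toBase ≅ CdashBase ⋙ incl` (★ `cdashBaseIso`).  In both, `𝒞⊢_v̲ = GaloisValDatum.Cdash = BadLocalKit.Cdash` is the REAL MONOGENIC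
[FrdII] Ex. 1.1 (ii) `p_v̲`-adic Frobenioid of `ℕ·log(q̲_v̲)` over `𝒟⊢_v̲ = CosetCat G_v̲`.
THE WITNESS.  `PadicFrobenioidMonogenicUnitInversionTwist` (this seat, engine): on every monogenic datum the UNIT-INVERSION TWIST
`σ(x, γ) = (x⁻¹·c^{2 deg γ}, γ)` is a `Div_B`-preserving natural automorphism of `B` moving the `Aut`-fixed divisor-free unit `1 + p`, so by
abc-iut-L1-t7's ★ `ModelFrobenioid.not_kernelTrivial_of_unitAut_of_fixed` BY NAME the kernel of `Aut(𝒞⊢_v̲) → Aut(𝒟⊢_v̲)` contains `Ψ_σ ≇ 𝟭`.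
WHAT THIS FILE PROVES (theorems only):
* §0 bookkeeping in the `RigidOverBase` currency (abc-iut-L5-t16 ★ `CatIsomorphism.RigidOverBase`): invariance under an isomorphism of structure
  functors (`rigidOverBase_congr`); DESCENT along a post-composition (`RigidOverBase.of_comp`: rigid over `p ⋙ G` ⇒ rigid over `p`) and to a
  SUMMAND (`RigidOverBase.inr`: rigid over `q : X ⊕ Y ⥤ B` ⇒ rigid over `Sum.inr_ X Y ⋙ q`, by extending a self-equivalence `e` of `Y` to
  `𝟭 ⊕ e` with `Functor.sumIsoExt` and cancelling the full faithful `inr_`); `sum_inr_full`.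
* §1 **`GaloisValDatum.not_rigidOverBase_cdashBase`** — `¬ RigidOverBase (d.CdashBase hq)` for EVERY Galois-valuation datum `d` and EVERY
  non-unit `q̲`; `InitialThetaData.not_rigidOverBase_frobeniusBadAt_cdashBase` — the same at the `𝒞⊢_v̲`-slot of the GENUINE Ex. 3.2 datum
  `D.frobeniusBadAt B I x hx` for EVERY merge record `I` (that slot does not depend on (m1)).
* §2 **(A)** `InitialThetaData.not_rigidOverBase_hull_ofGroupData` (every `m2`, `m4`), **`Cor53ii.not_kernelTrivial_hull_standIn_model`**
  (the named record `mergeInputsStandIn hA CG hTFG`); **(B)** `InitialThetaData.not_rigidOverBase_hull_ofGroupDataThetaTower` (every `m2`, `m4`,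
  `A₀`), **`Cor53ii.not_kernelTrivial_hull_standIn`** (`mergeInputsThetaTowerStandIn hA CG hTFG A₀`), `Cor53ii.not_kernelTrivial_hull_ofClosed`
  (`MergeInputs.thetaTowerOfClosed`): `¬ RigidOverBase ((D.frobeniusBadAt B I x hx).hull ⋙ (D.frobeniusBadAt B I x hx).toBase)` — i.e. the
  second conjunct of `badLiftAt_model_case_iff` is FALSE at these `I`, at EVERY bad index.
* §3 **the read-out itself FAILS at these `I`**: `InitialThetaData.not_bijective_badLiftAt_ofGroupData` / `…_ofGroupDataThetaTower` — over abc-iut-L5's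
  genuine §6 base kit of record `D.baseKitThetaNFOfBadPairs CG hS M hA hI B ΛBad`, the Cor 5.3 (ii) MODEL-CASE map `α ↦ toD(α)` of the `ℱ`-slot
  `badLiftToDAt … I x hx` is NOT bijective (★ `badLiftAt_model_case_iff` + §2).
CENSUS: binders = the records' own {`B`, `m2`, `m4`, `hTFG`, `A₀`} / {`hA`, `CG`, `hTFG`, `A₀`} / {`B`, `hH`, `hTFG`, `A₀`} ∪ {`x`, `hx`} (§3: ∪ the
kit's own {`CG`, `hS`, `M`, `hA`, `hI`, `ΛBad`, `Fact l.Prime`}); LAW 0 ·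
FACT 0 (F-0240 `hTFG` is the records' displayed field, consumed only to NAME them) · 0 def · 0 instance · 0 notation · no `Prop` fact · no sorry.
HONEST LABEL: «REFUTABLE-AS-TYPED AT OUR STAND-INS — their hull `𝒞_v̲` carries the split `⊢`-Frobenioid `𝒞⊢_v̲` (`𝒪^× · q̲^ℕ`) as a disjoint
summand, and unit inversion fixing `q̲_v̲` is a non-trivial self-equivalence over `𝟭_{𝒟_v̲}`; this is CONSISTENT with print's Cor. 5.3 (iii)
(surjectivity only, for `⊢`-strips) and does NOT hit print's Cor. 5.3 (ii): print's `‡𝒞_v̲` is the FULL `p_v̲`-adic Frobenioid (base-field-theoretic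
hull, `Φ = ord(𝒪^▷)`, Def 5.2 (i)(a) / Ex 3.2 (iii) / Ex 3.3 (i)), where no Galois-compatible uniformiser section exists and [AbsTopIII]
Prop. 3.2 (iv) — in the tree ★ `PadicFrd.Datum.hker_genuine` under (INT)/(PF) — applies; that is lane 2's TM-pair upgrade (abc-iut-L5-t5)».
No token is moved by this file; typed ≠ inhabited ≠ proved; refutable-as-typed ≠ refuted in print; nothing here asserts abc proved or refuted.
-/

noncomputable section

namespace Literature.IUT.HodgeTheaters

open CategoryTheory Opposite Literature.AnabelianGeometry.SemiGraphs Literature.AlgebraicGeometry.Frobenioids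
  Literature.AlgebraicGeometry.Frobenioids.PadicFrd Literature.AnabelianGeometry.EtaleTheta

/-! ### §0. `RigidOverBase`: invariance under isomorphism, descent along a post-composition and to a summand -/

section SumFull

universe v₁ v₂ u₁ u₂

variable (C : Type u₁) [Category.{v₁} C] (C' : Type u₂) [Category.{v₂} C']

/-- The right inclusion `C' ⥤ C ⊕ C'` is full (its action on morphisms is `ULift.up`, inverted by `ULift.down`). [folklore]
([IUTchI] Ex 3.2 (iii) p.71) [claim: Mochizuki2012, status: disputed] -/
theorem sum_inr_full : (Sum.inr_ C C').Full :=
  ⟨fun {_ _} f => ⟨f.down, rfl⟩⟩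

end SumFull

namespace CatIsomorphism

universe v₁ v₂ v₃ v₄ u₁ u₂ u₃ u₄

variable {C : Type u₁} [Category.{v₁} C] {B : Type u₂} [Category.{v₂} B] {B' : Type u₃} [Category.{v₃} B']

/-- **`RigidOverBase` depends on the structure functor only up to isomorphism** (a self-equivalence lies under `𝟭_B` through `p` iff it does
through `p' ≅ p`). ([IUTchI] Cor 5.3 (ii) p.144) [claim: Mochizuki2012, status: disputed] -/
theorem rigidOverBase_congr {p p' : C ⥤ B} (i : p ≅ p') : RigidOverBase p ↔ RigidOverBase p' := by
  constructor
  · rintro h Ψ ⟨j⟩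
    exact h Ψ ⟨Functor.isoWhiskerLeft Ψ.functor i ≪≫ j ≪≫ Functor.isoWhiskerRight i.symm _⟩
  · rintro h Ψ ⟨j⟩
    exact h Ψ ⟨Functor.isoWhiskerLeft Ψ.functor i.symm ≪≫ j ≪≫ Functor.isoWhiskerRight i _⟩

/-- **Descent of `RigidOverBase` along a post-composition**: if every self-equivalence of `C` lying over `𝟭_{B'}` through `p ⋙ G` is `≅ 𝟭`, then
so is every self-equivalence lying over `𝟭_B` through `p` (whisker its square with `G`).  Contrapositive: a witness against `RigidOverBase p`
kills `RigidOverBase (p ⋙ G)` for EVERY `G` (e.g. `G = 𝒟⊢_v ⊆ 𝒟_v`). ([IUTchI] Cor 5.3 (ii) p.144) [claim: Mochizuki2012, status: disputed] -/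
theorem RigidOverBase.of_comp {p : C ⥤ B} (G : B ⥤ B') (h : RigidOverBase (p ⋙ G)) : RigidOverBase p := by
  rintro Ψ ⟨j⟩
  refine h Ψ ⟨?_⟩
  exact (Functor.associator _ _ _).symm ≪≫ Functor.isoWhiskerRight (j ≪≫ p.rightUnitor) G ≪≫ (p ⋙ G).rightUnitor.symm

/-- **Descent of `RigidOverBase` to a summand**: if every self-equivalence of `X ⊕ Y` lying over `𝟭_B` through `q : X ⊕ Y ⥤ B` is `≅ 𝟭`, then
every self-equivalence `e` of `Y` lying over `𝟭_B` through `inr ⋙ q` is `≅ 𝟭_Y` — extend `e` to the self-equivalence `𝟭_X ⊕ e` of the sum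
(`Functor.sum'`, `Functor.sumIsoExt`), which lies over `𝟭_B` through `q`; an isomorphism `𝟭_X ⊕ e ≅ 𝟭` restricts along the full faithful
`inr` to `e ≅ 𝟭_Y` (`Functor.fullyFaithfulCancelRight`).  Contrapositive: a witness on a SUMMAND kills `RigidOverBase` of the sum.
([IUTchI] Cor 5.3 (ii) p.144) [claim: Mochizuki2012, status: disputed] -/
theorem RigidOverBase.inr {X : Type u₁} [Category.{v₁} X] {Y : Type u₄} [Category.{v₄} Y] (q : X ⊕ Y ⥤ B)
    (h : RigidOverBase q) : RigidOverBase (Sum.inr_ X Y ⋙ q) := by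
  rintro e ⟨j⟩
  -- the self-equivalence `𝟭_X ⊕ e` of `X ⊕ Y` and its restrictions to the two summands
  let F : X ⊕ Y ⥤ X ⊕ Y := (Sum.inl_ X Y).sum' (e.functor ⋙ Sum.inr_ X Y)
  let G : X ⊕ Y ⥤ X ⊕ Y := (Sum.inl_ X Y).sum' (e.inverse ⋙ Sum.inr_ X Y)
  let iFl : Sum.inl_ X Y ⋙ F ≅ Sum.inl_ X Y := Functor.inlCompSum' _ _
  let iFr : Sum.inr_ X Y ⋙ F ≅ e.functor ⋙ Sum.inr_ X Y := Functor.inrCompSum' _ _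
  let iGl : Sum.inl_ X Y ⋙ G ≅ Sum.inl_ X Y := Functor.inlCompSum' _ _
  let iGr : Sum.inr_ X Y ⋙ G ≅ e.inverse ⋙ Sum.inr_ X Y := Functor.inrCompSum' _ _
  let η : 𝟭 (X ⊕ Y) ≅ F ⋙ G :=
    Functor.sumIsoExt
      ((Sum.inl_ X Y).rightUnitor ≪≫ iGl.symm ≪≫ (Functor.isoWhiskerRight iFl G).symm ≪≫ Functor.associator _ _ _)
      ((Sum.inr_ X Y).rightUnitor ≪≫ (Sum.inr_ X Y).leftUnitor.symm ≪≫ Functor.isoWhiskerRight e.unitIso (Sum.inr_ X Y) ≪≫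
        Functor.associator _ _ _ ≪≫ Functor.isoWhiskerLeft e.functor iGr.symm ≪≫ (Functor.associator _ _ _).symm ≪≫
        Functor.isoWhiskerRight iFr.symm G ≪≫ Functor.associator _ _ _)
  let ε : G ⋙ F ≅ 𝟭 (X ⊕ Y) :=
    Functor.sumIsoExt
      ((Functor.associator _ _ _).symm ≪≫ Functor.isoWhiskerRight iGl F ≪≫ iFl ≪≫ (Sum.inl_ X Y).rightUnitor.symm)
      ((Functor.associator _ _ _).symm ≪≫ Functor.isoWhiskerRight iGr F ≪≫ Functor.associator _ _ _ ≪≫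
        Functor.isoWhiskerLeft e.inverse iFr ≪≫ (Functor.associator _ _ _).symm ≪≫
        Functor.isoWhiskerRight e.counitIso (Sum.inr_ X Y) ≪≫ (Sum.inr_ X Y).leftUnitor ≪≫ (Sum.inr_ X Y).rightUnitor.symm)
  let Ψ : X ⊕ Y ≌ X ⊕ Y := CategoryTheory.Equivalence.mk F G η ε
  -- `𝟭_X ⊕ e` lies over `𝟭_B` through `q`
  have k : Ψ.functor ⋙ q ≅ q ⋙ (CategoryTheory.Equivalence.refl (C := B)).functor :=
    Functor.sumIsoExt ((Functor.associator _ _ _).symm ≪≫ Functor.isoWhiskerRight iFl q)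
        ((Functor.associator _ _ _).symm ≪≫ Functor.isoWhiskerRight iFr q ≪≫ Functor.associator _ _ _ ≪≫ j ≪≫
          (Sum.inr_ X Y ⋙ q).rightUnitor) ≪≫
      q.rightUnitor.symm
  obtain ⟨m⟩ := h Ψ ⟨k⟩
  -- restrict `𝟭_X ⊕ e ≅ 𝟭` along the full faithful `inr`
  have m' : e.functor ⋙ Sum.inr_ X Y ≅ 𝟭 Y ⋙ Sum.inr_ X Y :=
    iFr.symm ≪≫ Functor.isoWhiskerLeft (Sum.inr_ X Y) m ≪≫ (Sum.inr_ X Y).rightUnitor ≪≫ (Sum.inr_ X Y).leftUnitor.symm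
  haveI : (Sum.inr_ X Y).Full := sum_inr_full X Y
  haveI : (Sum.inr_ X Y).Faithful := sum_inr_faithful X Y
  exact ⟨Functor.fullyFaithfulCancelRight (Sum.inr_ X Y) m'⟩

end CatIsomorphism

/-! ### §1. `𝒞⊢_v̲ → 𝒟⊢_v̲` is NOT rigid over its base: every Galois-valuation datum, every non-unit `q̲` -/

namespace GaloisValDatum

variable {p : ℕ} [Fact p.Prime] (d : GaloisValDatum.{0} p) {q : intNonzero d.k} (hq : ¬ IsUnit q)

/-- **¬ `hker` at the REAL `𝒞⊢_v`**: for every Galois-valuation datum `(K_v, K̄_v)` and every non-unit `q̲_v ∈ 𝒪^▷_{K_v}`, NOT every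
self-equivalence of `𝒞⊢_v` (the monogenic `p_v`-adic Frobenioid of `ℕ·log(q̲_v)` over `𝒟⊢_v = 𝓑(K_v)⁰`, ★ `GaloisValDatum.Cdash`) lying over
`𝟭_{𝒟⊢_v}` is `≅ 𝟭` — the unit-inversion twist is not (engine ★ `BadLocalKit.not_kernelTrivial_cdash`, via abc-iut-L1-t7's
★ `not_kernelTrivial_of_unitAut_of_fixed`).  OURS, at OUR model category; consistent with print's Cor 5.3 (iii) («surjective»).
([IUTchI] Ex 3.2 (iv) p.71) [claim: Mochizuki2012, status: disputed] -/
theorem not_rigidOverBase_cdashBase : ¬ CatIsomorphism.RigidOverBase (d.CdashBase hq) :=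
  BadLocalKit.not_kernelTrivial_cdash d.relEmb d.fieldFunctor_isPadicLocal CosetCat.isConnected CosetCat.isTotallyEpimorphic hq

/-- Hence **¬ `RigidOverBase (𝒞⊢_v → 𝒟⊢_v ⊆ 𝒟_v)`** through the pull-back inclusion of ANY bad-place group datum `T` (descent along the
post-composition, §0). ([IUTchI] Ex 3.2 (iv) p.71) [claim: Mochizuki2012, status: disputed] -/
theorem not_rigidOverBase_cdashBase_incl {P : Type} [Group P] [TopologicalSpace P] (T : BadLocalGroupDatum d.Gal P) :
    ¬ CatIsomorphism.RigidOverBase (d.CdashBase hq ⋙ T.incl) :=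
  fun h => d.not_rigidOverBase_cdashBase hq (CatIsomorphism.RigidOverBase.of_comp T.incl h)

end GaloisValDatum

namespace InitialThetaData

variable {F K Fbar : Type} [Field F] [NumberField F] [Field K] [NumberField K] [Algebra F K]
  [Field Fbar] [Algebra F Fbar] [Algebra K Fbar] {E : WeierstrassCurve F}
  [E.IsElliptic] {l : ℕ} {Pb : BadPlacePredicates K} (D : InitialThetaData F K Fbar E l Pb)
  (B : ∀ v, v ∈ D.indexCopyBad → D.BadPairAt v)

/-- **¬ `hker` at the `𝒞⊢_v̲`-slot of the GENUINE [IUTchI] Ex 3.2 datum `D.frobeniusBadAt B I x hx`, for EVERY merge record `I` and EVERY bad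
index**: that slot is the REAL `GaloisValDatum.Cdash (gvdAt x) (q̲_v̲)` whatever (m1) is (abc-iut-L5-t2 `ofKits`), and §1 applies.
([IUTchI] Ex 3.2 (iv) p.71) [claim: Mochizuki2012, status: disputed] -/
theorem not_rigidOverBase_frobeniusBadAt_cdashBase (I : D.MergeInputs B) (x : D.IndexCopy) (hx : x ∈ D.indexCopyBad) :
    ¬ CatIsomorphism.RigidOverBase (D.frobeniusBadAt B I x hx).CdashBase :=
  haveI : Fact (D.primeAt x (D.not_mem_arc_of_mem_bad hx)).Prime := D.fact_primeAt_prime x _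
  (D.gvdAt x (D.not_mem_arc_of_mem_bad hx)).not_rigidOverBase_cdashBase (D.qRootAtIdx_not_isUnit x hx)

/-! ### §2 (A). The stand-in whose hull IS `𝒞⊢_v̲` (`badTemperedSideModel`, `mergeInputsStandIn`) -/

section ModelStandIn

variable (m2 : ∀ x (hx : x ∈ D.indexCopyBad), BadLocalGroupDatum (D.GalAt x (D.not_mem_arc_of_mem_bad hx)) ↥(B x hx).H)
  (m4 : RealifiedGlobalSide) (hTFG : D.geom.extF.GeomTFG) (x : D.IndexCopy) (hx : x ∈ D.indexCopyBad)

/-- **(A) `hker@hull` is FALSE AS TYPED at the sum-model stand-in** (`I := MergeInputs.ofGroupData D B m2 m4 hTFG`, every `m2`, `m4`): there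
`𝒞_v̲ := 𝒞⊢_v̲` and `hull ⋙ toBase ≅ CdashBase ⋙ incl` (abc-iut-L5-t3 ★ `sumHullBaseIso`), so the second conjunct of ★ `badLiftAt_model_case_iff`
fails by §1. ([IUTchI] Cor 5.3 (ii) p.144) [claim: Mochizuki2012, status: disputed] -/
theorem not_rigidOverBase_hull_ofGroupData :
    ¬ CatIsomorphism.RigidOverBase
      ((D.frobeniusBadAt B (MergeInputs.ofGroupData D B m2 m4 hTFG) x hx).hull ⋙
        (D.frobeniusBadAt B (MergeInputs.ofGroupData D B m2 m4 hTFG) x hx).toBase) := by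
  haveI : Fact (D.primeAt x (D.not_mem_arc_of_mem_bad hx)).Prime := D.fact_primeAt_prime x _
  intro h
  refine (D.gvdAt x (D.not_mem_arc_of_mem_bad hx)).not_rigidOverBase_cdashBase_incl (D.qRootAtIdx_not_isUnit x hx) (m2 x hx) ?_
  exact (CatIsomorphism.rigidOverBase_congr
    (TemperedThetaInput.sumHullBaseIso (D.gvdAt x (D.not_mem_arc_of_mem_bad hx)) (m2 x hx) (D.qRootAtIdx_not_isUnit x hx))).1 h

end ModelStandIn

/-! ### §2 (B). The stand-in whose hull is `C_{A₀}^{bs-fld} ⊕ 𝒞⊢_v̲` (`badTemperedSideOfThetaTower` and its records) -/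

section ThetaTowerStandIn

variable (m2 : ∀ x (hx : x ∈ D.indexCopyBad), BadLocalGroupDatum (D.GalAt x (D.not_mem_arc_of_mem_bad hx)) ↥(B x hx).H)
  (m4 : RealifiedGlobalSide) (hTFG : D.geom.extF.GeomTFG) (A₀ : ConnectedPart (BTemp TateTowerKummerTwistRShear.Compat₃'))
  (x : D.IndexCopy) (hx : x ∈ D.indexCopyBad)

/-- **(B) `hker@hull` is FALSE AS TYPED at the [EtTh]-content stand-in** (`I := MergeInputs.ofGroupDataThetaTower D B m2 m4 hTFG A₀`, every
`m2`, `m4`, `A₀`): there `𝒞_v̲ := C_{A₀}^{bs-fld} ⊕ 𝒞⊢_v̲` and `inr ⋙ hull ⋙ toBase ≅ CdashBase ⋙ incl` (abc-iut-L2-t6 ★ `cdashBaseIso`), so by descent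
to the `𝒞⊢_v̲`-summand (§0 `RigidOverBase.inr`) the second conjunct of ★ `badLiftAt_model_case_iff` fails by §1.
([IUTchI] Cor 5.3 (ii) p.144) [claim: Mochizuki2012, status: disputed] -/
theorem not_rigidOverBase_hull_ofGroupDataThetaTower :
    ¬ CatIsomorphism.RigidOverBase
      ((D.frobeniusBadAt B (MergeInputs.ofGroupDataThetaTower D B m2 m4 hTFG A₀) x hx).hull ⋙
        (D.frobeniusBadAt B (MergeInputs.ofGroupDataThetaTower D B m2 m4 hTFG A₀) x hx).toBase) := by
  haveI : Fact (D.primeAt x (D.not_mem_arc_of_mem_bad hx)).Prime := D.fact_primeAt_prime x _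
  intro h
  refine (D.gvdAt x (D.not_mem_arc_of_mem_bad hx)).not_rigidOverBase_cdashBase_incl (D.qRootAtIdx_not_isUnit x hx) (m2 x hx) ?_
  exact (CatIsomorphism.rigidOverBase_congr
    (ThetaInputOfThetaTower.cdashBaseIso (m2 x hx) (D.qRootAtIdx_not_isUnit x hx) (fun _ => True) (fun _ => True) A₀)).1
      (CatIsomorphism.RigidOverBase.inr _ h)

end ThetaTowerStandIn

/-! ### §3. Hence the Cor 5.3 (ii) model-case READ-OUT at the `ℱ`-slot of a bad index FAILS at these records -/

section ReadOut

variable (CG : D.geom.pe.CuspGalois) (hS : D.CuspClassesNormaliserStable) [Fact l.Prime] (M : D.TorsionMonodromy)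
  (hA : D.geom.pe.ArrowCoveringClaims) (hI : ∀ k ∈ D.geom.pe.inertia D.geom.pe.ε1, M.tau (D.geom.embK k) = 0)
  (ΛBad : ∀ v (h : v ∈ D.indexCopyBad), D.LocalArrowLaw CG hS (B v h).H)
  (m2 : ∀ x (hx : x ∈ D.indexCopyBad), BadLocalGroupDatum (D.GalAt x (D.not_mem_arc_of_mem_bad hx)) ↥(B x hx).H)
  (m4 : RealifiedGlobalSide) (hTFG : D.geom.extF.GeomTFG) (A₀ : ConnectedPart (BTemp TateTowerKummerTwistRShear.Compat₃'))
  (x : D.IndexCopy) (hx : x ∈ D.indexCopyBad)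

/-- **(A) Over the genuine §6 base kit of record, the Cor 5.3 (ii) MODEL-CASE map `α ↦ toD(α)` of the `ℱ`-slot at a bad index is NOT bijective
when the merge record is the sum-model stand-in `MergeInputs.ofGroupData D B m2 m4 hTFG`** (abc-iut-L5-t16 ★ `badLiftAt_model_case_iff`: bijective
↔ `LiftsAll` ∧ `RigidOverBase (hull ⋙ toBase)`, and the second conjunct fails, §2 (A)).  OURS, at OUR kit; print's (ii) not hit.
([IUTchI] Cor 5.3 (ii) p.144) [claim: Mochizuki2012, status: disputed] -/
theorem not_bijective_badLiftAt_ofGroupData :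
    ¬ Function.Bijective (fun α : SingleObj.star _ ≅ SingleObj.star _ =>
        (show (D.baseKitThetaNFOfBadPairs CG hS M hA hI B ΛBad).model x ≅ (D.baseKitThetaNFOfBadPairs CG hS M hA hI B ΛBad).model x from
          (D.badLiftToDAt CG hS M hA hI B ΛBad (MergeInputs.ofGroupData D B m2 m4 hTFG) x hx).mapIso α)) :=
  fun hb => D.not_rigidOverBase_hull_ofGroupData B m2 m4 hTFG x hx
    ((D.badLiftAt_model_case_iff CG hS M hA hI B ΛBad (MergeInputs.ofGroupData D B m2 m4 hTFG) x hx).1 hb).2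

/-- **(B) The same at the [EtTh]-content stand-in `MergeInputs.ofGroupDataThetaTower D B m2 m4 hTFG A₀`**: the Cor 5.3 (ii) model-case map of the
`ℱ`-slot at a bad index is NOT bijective over the kit of record (§2 (B)).  OURS, at OUR kit; print's (ii) not hit.
([IUTchI] Cor 5.3 (ii) p.144) [claim: Mochizuki2012, status: disputed] -/
theorem not_bijective_badLiftAt_ofGroupDataThetaTower :
    ¬ Function.Bijective (fun α : SingleObj.star _ ≅ SingleObj.star _ =>
        (show (D.baseKitThetaNFOfBadPairs CG hS M hA hI B ΛBad).model x ≅ (D.baseKitThetaNFOfBadPairs CG hS M hA hI B ΛBad).model x from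
          (D.badLiftToDAt CG hS M hA hI B ΛBad (MergeInputs.ofGroupDataThetaTower D B m2 m4 hTFG A₀) x hx).mapIso α)) :=
  fun hb => D.not_rigidOverBase_hull_ofGroupDataThetaTower B m2 m4 hTFG A₀ x hx
    ((D.badLiftAt_model_case_iff CG hS M hA hI B ΛBad (MergeInputs.ofGroupDataThetaTower D B m2 m4 hTFG A₀) x hx).1 hb).2

end ReadOut

end InitialThetaData

/-! ### §2 (records of record). The headline at the named stand-in merge records -/

namespace Cor53ii

open InitialThetaData

variable {F K Fbar : Type} [Field F] [NumberField F] [Field K] [NumberField K] [Algebra F K]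
  [Field Fbar] [Algebra F Fbar] [Algebra K Fbar] {E : WeierstrassCurve F}
  [E.IsElliptic] {l : ℕ} {Pb : BadPlacePredicates K} (D : InitialThetaData F K Fbar E l Pb)

/-- **HEADLINE (B): `hker@hull` is FALSE AS TYPED at THE Θ-side stand-in of record** — the merge record `D.mergeInputsThetaTowerStandIn hA CG hTFG
A₀` at the `X̲→`-stand-in kit with the [EtTh]-content (m1) slots (abc-iut-L2-t7 ★ p510136): at EVERY bad index the law `RigidOverBase (hull ⋙
toBase)` of the hull slot `𝒞_v̲ = C_{A₀}^{bs-fld} ⊕ 𝒞⊢_v̲` fails, the `𝒞⊢_v̲`-summand carrying the unit-inversion twist.  «refutable-as-typed at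
OUR stand-in; print not hit (print's `‡𝒞_v̲` carries `𝒪^▷` with non-units, Def 5.2 (i)(a)/Ex 3.2 (iii), where [AbsTopIII] Prop 3.2 (iv)
applies — lane 2's TM-pair upgrade)». ([IUTchI] Cor 5.3 (ii) p.144) [claim: Mochizuki2012, status: disputed] -/
theorem not_kernelTrivial_hull_standIn (hA : D.geom.pe.ArrowCoveringClaims) (CG : D.geom.pe.CuspGalois) (hTFG : D.geom.extF.GeomTFG)
    (A₀ : ConnectedPart (BTemp TateTowerKummerTwistRShear.Compat₃')) (x : D.IndexCopy) (hx : x ∈ D.indexCopyBad) :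
    ¬ CatIsomorphism.RigidOverBase
      ((D.frobeniusBadAt _ (D.mergeInputsThetaTowerStandIn hA CG hTFG A₀) x hx).hull ⋙
        (D.frobeniusBadAt _ (D.mergeInputsThetaTowerStandIn hA CG hTFG A₀) x hx).toBase) :=
  D.not_rigidOverBase_hull_ofGroupDataThetaTower _ _ _ hTFG A₀ x hx

/-- The same at EVERY CLOSED bad-pair family (`MergeInputs.thetaTowerOfClosed D B hH hTFG A₀`, abc-iut-L2-t7 ★ p510136 §4).
([IUTchI] Cor 5.3 (ii) p.144) [claim: Mochizuki2012, status: disputed] -/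
theorem not_kernelTrivial_hull_ofClosed (B : ∀ v, v ∈ D.indexCopyBad → D.BadPairAt v)
    (hH : ∀ x (hx : x ∈ D.indexCopyBad), IsClosed ((B x hx).H : Set D.PiC)) (hTFG : D.geom.extF.GeomTFG)
    (A₀ : ConnectedPart (BTemp TateTowerKummerTwistRShear.Compat₃')) (x : D.IndexCopy) (hx : x ∈ D.indexCopyBad) :
    ¬ CatIsomorphism.RigidOverBase
      ((D.frobeniusBadAt B (MergeInputs.thetaTowerOfClosed D B hH hTFG A₀) x hx).hull ⋙
        (D.frobeniusBadAt B (MergeInputs.thetaTowerOfClosed D B hH hTFG A₀) x hx).toBase) :=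
  D.not_rigidOverBase_hull_ofGroupDataThetaTower B _ _ hTFG A₀ x hx

/-- **HEADLINE (A): `hker@hull` is FALSE AS TYPED at the sum-model stand-in of record** `D.mergeInputsStandIn hA CG hTFG` (abc-iut-L5-t3 /
abc-iut-w4-d077 ★ p501395/★ p500756: `𝒞_v̲ := 𝒞⊢_v̲`), at EVERY bad index. ([IUTchI] Cor 5.3 (ii) p.144) [claim: Mochizuki2012, status: disputed] -/
theorem not_kernelTrivial_hull_standIn_model (hA : D.geom.pe.ArrowCoveringClaims) (CG : D.geom.pe.CuspGalois) (hTFG : D.geom.extF.GeomTFG)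
    (x : D.IndexCopy) (hx : x ∈ D.indexCopyBad) :
    ¬ CatIsomorphism.RigidOverBase
      ((D.frobeniusBadAt _ (D.mergeInputsStandIn hA CG hTFG) x hx).hull ⋙ (D.frobeniusBadAt _ (D.mergeInputsStandIn hA CG hTFG) x hx).toBase) :=
  D.not_rigidOverBase_hull_ofGroupData _ _ _ hTFG x hx

end Cor53ii

end Literature.IUT.HodgeTheaters

end
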